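import Mathlib
import Summits.Ventures.PercRepro2.SPEquivList

/-! # A normal form for SP terms up to bracketing and order
(seat mine-b, cell pub-perc-repro2; MINE-B.md §26.7)

`SP.toNat` codes terms injectively (`Nat.pair`), `SP.le` compares the codes, and `SP.nf` rewrites a
term as the left-nested composition of its sorted flattened factors, recursively.  `SP.Equiv.nf`:
every term is equivalent to its normal form, so (UH*) of a term follows from (UH*) of its normal
form (`SP.universal_of_nf`) — the reduction behind a single theorem for all terms of a given size. -/

namespace Summit.Ventures.PercRepro2.V2Closure

open Summit.Ventures.PercRepro2.UHClosure

/-- an injective code of terms -/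
def SP.toNat : SP → ℕ
  | .free => 0
  | .pin => 1
  | .absent => 2
  | .ser s t => 2 * Nat.pair s.toNat t.toNat + 3
  | .par s t => 2 * Nat.pair s.toNat t.toNat + 4

/-- **the code is injective** -/
theorem SP.toNat_injective : Function.Injective SP.toNat := by
  intro s
  induction s with
  | free => intro t h; cases t <;> (simp only [SP.toNat] at h; first | rfl | omega)
  | pin => intro t h; cases t <;> (simp only [SP.toNat] at h; first | rfl | omega)
  | absent => intro t h; cases t <;> (simp only [SP.toNat] at h; first | rfl | omega)
  | ser s₁ s₂ ih₁ ih₂ =>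
    intro t h
    cases t with
    | ser t₁ t₂ =>
      simp only [SP.toNat] at h
      have hp : Nat.pair s₁.toNat s₂.toNat = Nat.pair t₁.toNat t₂.toNat := by omega
      obtain ⟨h1, h2⟩ := Nat.pair_eq_pair.1 hp
      rw [ih₁ h1, ih₂ h2]
    | _ => simp only [SP.toNat] at h; omega
  | par s₁ s₂ ih₁ ih₂ =>
    intro t h
    cases t with
    | par t₁ t₂ =>
      simp only [SP.toNat] at h
      have hp : Nat.pair s₁.toNat s₂.toNat = Nat.pair t₁.toNat t₂.toNat := by omega
      obtain ⟨h1, h2⟩ := Nat.pair_eq_pair.1 hp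
      rw [ih₁ h1, ih₂ h2]
    | _ => simp only [SP.toNat] at h; omega

/-- the comparison of terms by their codes -/
def SP.le (s t : SP) : Bool := decide (s.toNat ≤ t.toNat)

/-- `SP.le` is total -/
theorem SP.le_total (s t : SP) : SP.le s t || SP.le t s := by
  unfold SP.le
  rcases Nat.le_total s.toNat t.toNat with h | h <;> simp [h]

/-- `SP.le` is transitive -/
theorem SP.le_trans {s t u : SP} (h₁ : SP.le s t) (h₂ : SP.le t u) : SP.le s u := by
  unfold SP.le at *
  simp only [decide_eq_true_eq] at *
  exact Nat.le_trans h₁ h₂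

/-- `SP.le` is antisymmetric: the codes are injective -/
theorem SP.le_antisymm {s t : SP} (h₁ : SP.le s t) (h₂ : SP.le t s) : s = t := by
  unfold SP.le at *
  simp only [decide_eq_true_eq] at *
  exact SP.toNat_injective (Nat.le_antisymm h₁ h₂)

/-- the left-nested composition of a nonempty list (`pin` for the empty list, never used) -/
def SP.serOfList : List SP → SP
  | [] => .pin
  | a :: l => SP.serL a l

/-- the left-nested parallel composition of a nonempty list -/
def SP.parOfList : List SP → SP
  | [] => .pin
  | a :: l => SP.parL a l

/-- **the normal form**: the factors of the normalised children, flattened, sorted, re-nested -/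
def SP.nf : SP → SP
  | .ser s t => SP.serOfList ((s.nf.serFactors ++ t.nf.serFactors).mergeSort SP.le)
  | .par s t => SP.parOfList ((s.nf.parFactors ++ t.nf.parFactors).mergeSort SP.le)
  | s => s

/-- a permutation of nonempty lists gives equivalent series compositions, whatever the heads -/
theorem SP.Equiv.serL_perm_cons {x y : SP} {l l' : List SP} (h : (x :: l).Perm (y :: l')) :
    SP.Equiv (SP.serL x l) (SP.serL y l') := by
  have hy : y ∈ x :: l := h.symm.subset (List.mem_cons_self ..)
  rcases List.mem_cons.1 hy with rfl | hy
  · exact SP.Equiv.serL_perm _ (List.Perm.cons_inv h)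
  · obtain ⟨l₁, l₂, rfl⟩ := List.append_of_mem hy
    have h1 : SP.Equiv (SP.serL x (l₁ ++ y :: l₂)) (SP.serL y (l₂ ++ x :: l₁)) :=
      (SP.Equiv.serL_append x y l₁ l₂).trans
        ((SP.Equiv.ser_comm _ _).trans (SP.Equiv.serL_append y x l₂ l₁).symm)
    have e1 : (y :: (l₂ ++ x :: l₁)).Perm (y :: x :: (l₂ ++ l₁)) := List.perm_middle.cons y
    have e2 : (y :: x :: (l₂ ++ l₁)).Perm (x :: y :: (l₂ ++ l₁)) := List.Perm.swap x y _
    have e3 : (x :: y :: (l₂ ++ l₁)).Perm (x :: y :: (l₁ ++ l₂)) := (List.perm_append_comm.cons y).cons x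
    have e4 : (x :: y :: (l₁ ++ l₂)).Perm (x :: (l₁ ++ y :: l₂)) := List.perm_middle.symm.cons x
    have h2 : (l₂ ++ x :: l₁).Perm l' := List.Perm.cons_inv (e1.trans (e2.trans (e3.trans (e4.trans h))))
    exact h1.trans (SP.Equiv.serL_perm y h2)

/-- a permutation of nonempty lists gives equivalent parallel compositions, whatever the heads -/
theorem SP.Equiv.parL_perm_cons {x y : SP} {l l' : List SP} (h : (x :: l).Perm (y :: l')) :
    SP.Equiv (SP.parL x l) (SP.parL y l') := by
  have hy : y ∈ x :: l := h.symm.subset (List.mem_cons_self ..)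
  rcases List.mem_cons.1 hy with rfl | hy
  · exact SP.Equiv.parL_perm _ (List.Perm.cons_inv h)
  · obtain ⟨l₁, l₂, rfl⟩ := List.append_of_mem hy
    have h1 : SP.Equiv (SP.parL x (l₁ ++ y :: l₂)) (SP.parL y (l₂ ++ x :: l₁)) :=
      (SP.Equiv.parL_append x y l₁ l₂).trans
        ((SP.Equiv.par_comm _ _).trans (SP.Equiv.parL_append y x l₂ l₁).symm)
    have e1 : (y :: (l₂ ++ x :: l₁)).Perm (y :: x :: (l₂ ++ l₁)) := List.perm_middle.cons y
    have e2 : (y :: x :: (l₂ ++ l₁)).Perm (x :: y :: (l₂ ++ l₁)) := List.Perm.swap x y _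
    have e3 : (x :: y :: (l₂ ++ l₁)).Perm (x :: y :: (l₁ ++ l₂)) := (List.perm_append_comm.cons y).cons x
    have e4 : (x :: y :: (l₁ ++ l₂)).Perm (x :: (l₁ ++ y :: l₂)) := List.perm_middle.symm.cons x
    have h2 : (l₂ ++ x :: l₁).Perm l' := List.Perm.cons_inv (e1.trans (e2.trans (e3.trans (e4.trans h))))
    exact h1.trans (SP.Equiv.parL_perm y h2)

/-- **every term is equivalent to its normal form** -/
theorem SP.Equiv.nf (s : SP) : SP.Equiv s s.nf := by
  induction s with
  | ser s t ihs iht =>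
    obtain ⟨a, la, ha⟩ := List.exists_cons_of_ne_nil (SP.serFactors_ne_nil s.nf)
    obtain ⟨b, lb, hb⟩ := List.exists_cons_of_ne_nil (SP.serFactors_ne_nil t.nf)
    have hperm := List.mergeSort_perm (s.nf.serFactors ++ t.nf.serFactors) SP.le
    have hne : (s.nf.serFactors ++ t.nf.serFactors).mergeSort SP.le ≠ [] := by
      intro h0
      have hl := hperm.length_eq
      rw [h0, ha] at hl
      simp at hl
    obtain ⟨c, lc, hc⟩ := List.exists_cons_of_ne_nil hne
    show SP.Equiv (SP.ser s t) (SP.serOfList ((s.nf.serFactors ++ t.nf.serFactors).mergeSort SP.le))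
    rw [hc]
    show SP.Equiv (SP.ser s t) (SP.serL c lc)
    rw [hc, ha, hb] at hperm
    have hp : (a :: (la ++ b :: lb)).Perm (c :: lc) := by simpa using hperm.symm
    exact ((SP.Equiv.ser_congr ihs iht).trans (SP.Equiv.ser_congr (SP.Equiv.serL_serFactors s.nf ha)
      (SP.Equiv.serL_serFactors t.nf hb))).trans
      ((SP.Equiv.serL_append a b la lb).symm.trans (SP.Equiv.serL_perm_cons hp))
  | par s t ihs iht =>
    obtain ⟨a, la, ha⟩ := List.exists_cons_of_ne_nil (SP.parFactors_ne_nil s.nf)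
    obtain ⟨b, lb, hb⟩ := List.exists_cons_of_ne_nil (SP.parFactors_ne_nil t.nf)
    have hperm := List.mergeSort_perm (s.nf.parFactors ++ t.nf.parFactors) SP.le
    have hne : (s.nf.parFactors ++ t.nf.parFactors).mergeSort SP.le ≠ [] := by
      intro h0
      have hl := hperm.length_eq
      rw [h0, ha] at hl
      simp at hl
    obtain ⟨c, lc, hc⟩ := List.exists_cons_of_ne_nil hne
    show SP.Equiv (SP.par s t) (SP.parOfList ((s.nf.parFactors ++ t.nf.parFactors).mergeSort SP.le))
    rw [hc]
    show SP.Equiv (SP.par s t) (SP.parL c lc)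
    rw [hc, ha, hb] at hperm
    have hp : (a :: (la ++ b :: lb)).Perm (c :: lc) := by simpa using hperm.symm
    exact ((SP.Equiv.par_congr ihs iht).trans (SP.Equiv.par_congr (SP.Equiv.parL_parFactors s.nf ha)
      (SP.Equiv.parL_parFactors t.nf hb))).trans
      ((SP.Equiv.parL_append a b la lb).symm.trans (SP.Equiv.parL_perm_cons hp))
  | free => exact SP.Equiv.refl _
  | pin => exact SP.Equiv.refl _
  | absent => exact SP.Equiv.refl _

/-- **(UH*) of a term from (UH*) of its normal form** -/
theorem SP.universal_of_nf (s : SP) (h : Universal s.nf.rLab s.nf.bLab) : Universal s.rLab s.bLab :=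
  SP.universal_of_equiv (SP.Equiv.nf s).symm h

/-- **(UH*) of the normal form from (UH*) of the term** -/
theorem SP.universal_nf (s : SP) (h : Universal s.rLab s.bLab) : Universal s.nf.rLab s.nf.bLab :=
  SP.universal_of_equiv (SP.Equiv.nf s) h

end Summit.Ventures.PercRepro2.V2Closure
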